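import Mathlib
import Literature.Computability.Complexity.SymmetricCircuit
import Literature.Computability.Complexity.CircuitComposition
import Literature.Computability.Complexity.NegationElimination
import Literature.Computability.Complexity.CircuitRestriction

/-!
# Stub `stub_headerHardwiring` of line `canonical-form-completeness` for crux
`SymmetryBudget.WindowBarrier` (item stmt-PneNP-2145, route route-PneNP-SymmetryBudget)

**Symmetric circuits are closed under hard-wiring constants into `Γ`-fixed inputs.**
If some `Γ`-symmetric `tcBasis`-circuit `C` with at most `s` gates computes
`f : (Fin m × Fin m → Bool) → Bool`, and every `ρ ∈ Γ` fixes every index `i < t`, then for every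
constant "header block" `h : Fin m × Fin m → Bool` some `Γ`-symmetric `tcBasis`-circuit with at
most `s + 2` gates computes `x ↦ f (x with the entries (u, v), u, v < t, overwritten by h)`.

Construction (straight-line programs of `Literature.Computability.Complexity.Circuit`, gate-list
calculus of `CircuitComposition`): the new program is

`D = [∧₀, ∨₀] ++ C.gates.map (GateList.reloc φ 2)`, output `GateList.shiftWire φ 2 C.output`,

where the two arity-`0` gates `∧₀ = 1`, `∨₀ = 0` lie in `acBasis ⊆ tcBasis`
(`GateFn.const true = GateFn.and 0`), every back-reference of `C` is shifted by `2`, and the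
input wire `(u, v)` is rewired to `φ (u, v)`: the constant gate `h (u, v)` if `u, v < t`, itself
otherwise. Evaluation is `GateList.vals_append_reloc`. For the symmetry, an automorphism `σ` of
`C` extending `ρ × ρ` is lifted to the permutation `τ = id ⊕ σ` of the gates of `D` (the two
constant gates are fixed, gate `j + 2` goes to `σ j + 2`); the key identity is
`relabelWire (ρ×ρ) τ ∘ shiftWire φ 2 = shiftWire φ 2 ∘ relabelWire (ρ×ρ) σ` on all wires, which
holds because `ρ × ρ` fixes the header entries (`ρ` fixes all `i < t`) and maps non-header entries
to non-header entries (`ρ` is a bijection fixing all `i < t`). The argument-multiset condition of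
`Circuit.IsInducedAut` is transported along this identity with `List.Perm.map`.
Folklore (Anderson–Dawar 2017, §2: restrictions of symmetric circuits).
-/

-- `Summit.PneNP.PneNP.…` duplicates `PneNP` BY DESIGN (single-problem summit).
set_option linter.dupNamespace false

namespace Summit.PneNP.PneNP.Theorems

open Literature.Computability.Complexity Literature.Computability.Complexity.GateList

namespace HeaderHardwiring

variable {ι : Type*}

/-! ### Lifting a gate permutation behind a fixed prefix -/

/-- `relabelGate σ.symm` undoes `relabelGate σ` in range. -/
theorem relabelGate_symm_relabelGate {n : ℕ} (σ : Equiv.Perm (Fin n)) {k : ℕ} (hk : k < n) :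
    Circuit.relabelGate σ.symm (Circuit.relabelGate σ k) = k := by
  rw [Circuit.relabelGate_of_lt σ hk, Circuit.relabelGate_of_lt σ.symm (σ ⟨k, hk⟩).2, Fin.eta,
    Equiv.symm_apply_apply]

/-- The lifted index map `k ↦ k` (`k < L`), `k ↦ σ (k - L) + L` (`k ≥ L`) stays below `n + L`. -/
theorem lift_lt {n L : ℕ} (θ : Equiv.Perm (Fin n)) {v : ℕ} (hv : v < n + L) :
    (if v < L then v else Circuit.relabelGate θ (v - L) + L) < n + L := by
  split_ifs with h
  · exact hv
  · have := Circuit.relabelGate_lt θ (k := v - L) (by omega)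
    omega

/-- The lifted index map of `θ.symm` is a left inverse of the lifted index map of `θ`. -/
theorem lift_inv {n L : ℕ} (θ : Equiv.Perm (Fin n)) {v : ℕ} (hv : v < n + L) :
    (if (if v < L then v else Circuit.relabelGate θ (v - L) + L) < L then
        (if v < L then v else Circuit.relabelGate θ (v - L) + L)
      else Circuit.relabelGate θ.symm
          ((if v < L then v else Circuit.relabelGate θ (v - L) + L) - L) + L) = v := by
  by_cases h : v < L
  · simp only [if_pos h]
  · have h1 : ¬ Circuit.relabelGate θ (v - L) + L < L := by omega
    simp only [if_neg h, if_neg h1, Nat.add_sub_cancel]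
    rw [relabelGate_symm_relabelGate θ (k := v - L) (by omega)]
    omega

/-- **The lifted permutation `id ⊕ σ`.** For `σ` a permutation of `Fin n` and `N = n + L` there is
a permutation `τ` of `Fin N` whose index relabelling fixes every `k < L` and acts as `σ`, shifted
by `L`, on the indices `≥ L` (also out of range, where both relabellings are the identity). -/
theorem exists_liftPerm {N n : ℕ} (L : ℕ) (hN : N = n + L) (σ : Equiv.Perm (Fin n)) :
    ∃ τ : Equiv.Perm (Fin N), ∀ k : ℕ,
      Circuit.relabelGate τ k = if k < L then k else Circuit.relabelGate σ (k - L) + L := by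
  subst hN
  refine ⟨⟨fun i => ⟨if (i : ℕ) < L then (i : ℕ) else Circuit.relabelGate σ (i - L) + L,
      lift_lt σ i.2⟩,
    fun i => ⟨if (i : ℕ) < L then (i : ℕ) else Circuit.relabelGate σ.symm (i - L) + L,
      lift_lt σ.symm i.2⟩,
    fun i => Fin.ext (lift_inv σ i.2),
    fun i => Fin.ext (by simpa only [Equiv.symm_symm] using lift_inv σ.symm i.2)⟩, fun k => ?_⟩
  by_cases hk : k < n + L
  · rw [Circuit.relabelGate_of_lt _ hk]
    rfl
  · have h1 : ¬ k < L := by omega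
    rw [Circuit.relabelGate_of_le _ (not_lt.1 hk), if_neg h1,
      Circuit.relabelGate_of_le σ (k := k - L) (by omega)]
    omega

/-! ### Relocating a program behind a prefix of wireless gates -/

/-- Indexing into the relocated part: `(pre ++ l.map f)[i + |pre|] = f l[i]`. -/
theorem getElem_append_map_add {α β : Type*} (pre : List α) (l : List β) (f : β → α) (i : ℕ)
    (hi : i < l.length) (h : i + pre.length < (pre ++ l.map f).length) :
    (pre ++ l.map f)[i + pre.length] = f l[i] := by
  rw [List.getElem_append_right (by omega)]
  simp only [Nat.add_sub_cancel, List.getElem_map]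

/-- The argument list of a relocated gate is the shifted argument list. -/
theorem ofFn_reloc_args {ι' : Type*} (φ : ι' → ι ⊕ ℕ) (L : ℕ) (g : Gate ι') :
    List.ofFn (reloc φ L g).args = (List.ofFn g.args).map (shiftWire φ L) := by
  rw [List.map_ofFn]
  rfl

/-- **The key identity.** If the index relabelling of `τ` is that of `σ` lifted behind `L` fixed
gates, and the input wiring `φ` (into the first `L` gates) intertwines `π`, i.e.
`φ (π q) = (π ⊕ id) (φ q)`, then relabelling by `(π, τ)` after shifting equals shifting after
relabelling by `(π, σ)`, on every wire. -/
theorem relabelWire_shiftWire {n N L : ℕ} (π : ι → ι) (σ : Equiv.Perm (Fin n))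
    (τ : Equiv.Perm (Fin N))
    (hτ : ∀ k : ℕ, Circuit.relabelGate τ k =
      if k < L then k else Circuit.relabelGate σ (k - L) + L)
    (φ : ι → ι ⊕ ℕ) (hφ : WiresOK L φ) (hφπ : ∀ q, φ (π q) = Sum.map π id (φ q))
    (w : ι ⊕ ℕ) :
    Circuit.relabelWire π τ (shiftWire φ L w) = shiftWire φ L (Circuit.relabelWire π σ w) := by
  cases w with
  | inl q =>
    simp only [shiftWire, Circuit.relabelWire_inl]
    rw [hφπ q]
    cases hq : φ q with
    | inl q' => rfl
    | inr c =>
      have hc : c < L := hφ q c hq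
      rw [Circuit.relabelWire_inr, hτ, if_pos hc]
      rfl
  | inr k =>
    simp only [shiftWire, Circuit.relabelWire_inr]
    have h1 : ¬ k + L < L := by omega
    rw [hτ, if_neg h1, Nat.add_sub_cancel]

/-- **Automorphisms survive hard-wiring.** Let `D` be the program `pre ++ C.gates` with `C`
relocated behind a prefix `pre` of arity-`0` gates along the input wiring `φ` (into `pre`), with
output the shifted output of `C`. If `φ` intertwines `π` (`φ (π q) = (π ⊕ id) (φ q)`), then every
automorphism `σ` of `C` extending `π` lifts to an automorphism `id ⊕ σ` of `D` extending `π`. -/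
theorem exists_isInducedAut_hardwire (pre : List (Gate ι)) (hpre : ∀ g ∈ pre, g.arity = 0)
    (C D : Circuit ι) (φ : ι → ι ⊕ ℕ) (hφ : WiresOK pre.length φ)
    (hDg : D.gates = pre ++ C.gates.map (reloc φ pre.length))
    (hDo : D.output = shiftWire φ pre.length C.output)
    {π : ι → ι} (hφπ : ∀ q, φ (π q) = Sum.map π id (φ q))
    {σ : Equiv.Perm (Fin C.gates.length)} (hσ : C.IsInducedAut π σ) :
    ∃ τ : Equiv.Perm (Fin D.gates.length), D.IsInducedAut π τ := by
  obtain ⟨Dg, Do, hwf, ho⟩ := D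
  dsimp only at hDg hDo
  subst hDg hDo
  have hN : (pre ++ C.gates.map (reloc φ pre.length)).length = C.gates.length + pre.length := by
    simp only [List.length_append, List.length_map]
    omega
  obtain ⟨τ, hτ⟩ := exists_liftPerm pre.length hN σ
  have hcomm := relabelWire_shiftWire π σ τ hτ φ hφ hφπ
  refine ⟨τ, ?_, ?_⟩
  · show Circuit.relabelWire π τ (shiftWire φ pre.length C.output) =
      shiftWire φ pre.length C.output
    rw [hcomm, hσ.1]
  · rintro ⟨j, hj⟩
    have hjN : j < C.gates.length + pre.length := by rw [← hN]; exact hj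
    simp only [Fin.getElem_fin]
    rcases Nat.lt_or_ge j pre.length with hjL | hjL
    · -- one of the wireless prefix gates: fixed by `τ`, empty argument list
      have hv : ((τ ⟨j, hj⟩ : Fin _) : ℕ) = j := by
        rw [← Circuit.relabelGate_of_lt τ hj, hτ j, if_pos hjL]
      rw [getElem_congr_idx hv]
      rw [List.getElem_append_left hjL]
      refine ⟨rfl, ?_⟩
      have h0 : (pre[j]).arity = 0 := hpre _ (List.getElem_mem hjL)
      rw [List.ofFn_eq_nil_iff.2 h0, List.map_nil]
    · -- a relocated gate `k + |pre|` of `C`: goes to `σ k + |pre|`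
      obtain ⟨k, rfl⟩ : ∃ k, j = k + pre.length := ⟨j - pre.length, by omega⟩
      have hk : k < C.gates.length := by omega
      have hv : ((τ ⟨k + pre.length, hj⟩ : Fin _) : ℕ) = (σ ⟨k, hk⟩ : ℕ) + pre.length := by
        have h1 : ¬ k + pre.length < pre.length := by omega
        rw [← Circuit.relabelGate_of_lt τ hj, hτ, if_neg h1, Nat.add_sub_cancel,
          Circuit.relabelGate_of_lt σ hk]
      rw [getElem_congr_idx hv]
      rw [getElem_append_map_add pre C.gates (reloc φ pre.length) (σ ⟨k, hk⟩) (σ ⟨k, hk⟩).2,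
        getElem_append_map_add pre C.gates (reloc φ pre.length) k hk]
      obtain ⟨hfn, hperm⟩ := hσ.2 ⟨k, hk⟩
      simp only [Fin.getElem_fin] at hfn hperm
      refine ⟨by rw [reloc_fn, reloc_fn]; exact hfn, ?_⟩
      rw [ofFn_reloc_args, ofFn_reloc_args]
      have hmm : ((List.ofFn (C.gates[k]).args).map (Circuit.relabelWire π σ)).map
            (shiftWire φ pre.length) =
          ((List.ofFn (C.gates[k]).args).map (shiftWire φ pre.length)).map
            (Circuit.relabelWire π τ) := by
        rw [List.map_map, List.map_map]
        exact List.map_congr_left fun w _ => (hcomm w).symm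
      rw [← hmm]
      exact hperm.map _

/-- The hard-wired program computes `C` on the inputs read off the wiring `φ` into the prefix. -/
theorem eval_hardwire (pre : List (Gate ι)) (C D : Circuit ι) (φ : ι → ι ⊕ ℕ)
    (hφ : WiresOK pre.length φ) (hDg : D.gates = pre ++ C.gates.map (reloc φ pre.length))
    (hDo : D.output = shiftWire φ pre.length C.output) (x : ι → Bool) :
    D.eval x = C.eval (fun i => wireOf x (vals pre x) (φ i)) := by
  rw [circuit_eval, circuit_eval, hDg, hDo, vals_append_reloc pre C.gates φ hφ x,
    wireOf_shiftWire x _ _ (length_vals pre x) φ hφ]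

/-- The hard-wired program is over any basis containing the prefix gates and the gates of `C`. -/
theorem isOver_hardwire {B : Set GateFn} (pre : List (Gate ι)) (hpre : ∀ g ∈ pre, g.fn ∈ B)
    (C D : Circuit ι) (hC : C.IsOver B) (φ : ι → ι ⊕ ℕ) (L : ℕ)
    (hDg : D.gates = pre ++ C.gates.map (reloc φ L)) : D.IsOver B := by
  intro g hg
  rw [hDg, List.mem_append, List.mem_map] at hg
  rcases hg with hg | ⟨g', hg', rfl⟩
  · exact hpre g hg
  · rw [reloc_fn]
    exact hC g' hg'

/-- The hard-wired program has `|pre|` more gates than `C`. -/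
theorem size_hardwire (pre : List (Gate ι)) (C D : Circuit ι) (φ : ι → ι ⊕ ℕ) (L : ℕ)
    (hDg : D.gates = pre ++ C.gates.map (reloc φ L)) : D.size = C.size + pre.length := by
  simp only [Circuit.size, hDg, List.length_append, List.length_map]
  omega

/-- The hard-wired program exists as a `Circuit` (well-formedness from `GateList.WF.append_reloc`,
output validity from `GateList.wiresOK_shiftWire`). -/
theorem exists_hardwire (pre : List (Gate ι)) (hpre : WF pre) (C : Circuit ι) (φ : ι → ι ⊕ ℕ)
    (hφ : WiresOK pre.length φ) :
    ∃ D : Circuit ι, D.gates = pre ++ C.gates.map (reloc φ pre.length) ∧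
      D.output = shiftWire φ pre.length C.output := by
  have hout : WiresOK C.gates.length (fun _ : Unit => C.output) := fun _ k hk => C.wf_output k hk
  have ho := wiresOK_shiftWire hφ hout
  refine ⟨toCircuit (pre ++ C.gates.map (reloc φ pre.length)) (shiftWire φ pre.length C.output)
    (hpre.append_reloc (wf_gates C) hφ) (fun k hk => ?_), rfl, rfl⟩
  have := ho () k hk
  simp only [List.length_append, List.length_map]
  exact this

/-- **Symmetry survives hard-wiring (matrix inputs).** If the wiring `φ` intertwines the diagonal
action of every `ρ ∈ Γ`, then the hard-wired program of a `Γ`-symmetric circuit is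
`Γ`-symmetric. -/
theorem isSymmetricUnder_hardwire {m : ℕ} (Γ : Set (Equiv.Perm (Fin m)))
    (pre : List (Gate (Fin m × Fin m))) (hpre : ∀ g ∈ pre, g.arity = 0)
    (C D : Circuit (Fin m × Fin m)) (φ : Fin m × Fin m → (Fin m × Fin m) ⊕ ℕ)
    (hφ : WiresOK pre.length φ)
    (hDg : D.gates = pre ++ C.gates.map (reloc φ pre.length))
    (hDo : D.output = shiftWire φ pre.length C.output)
    (hφΓ : ∀ ρ ∈ Γ, ∀ q : Fin m × Fin m,
      φ (ρ q.1, ρ q.2) = Sum.map (fun q : Fin m × Fin m => (ρ q.1, ρ q.2)) id (φ q))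
    (hC : C.IsSymmetricUnder Γ) : D.IsSymmetricUnder Γ := by
  intro ρ hρ
  obtain ⟨σ, hσ⟩ := hC ρ hρ
  exact exists_isInducedAut_hardwire pre hpre C D φ hφ hDg hDo
    (π := fun q : Fin m × Fin m => (ρ q.1, ρ q.2)) (hφΓ ρ hρ) hσ

/-! ### The header wiring and the two constant gates -/

/-- A permutation fixing every index `< t` maps no index `≥ t` below `t`. -/
theorem lt_of_apply_lt {m t : ℕ} {ρ : Equiv.Perm (Fin m)} (hρ : ∀ i : Fin m, (i : ℕ) < t → ρ i = i)
    {i : Fin m} (h : ((ρ i : Fin m) : ℕ) < t) : (i : ℕ) < t := by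
  have h2 : ρ i = i := ρ.injective (hρ (ρ i) h)
  rw [← h2]
  exact h

/-- **The header wiring.** `φ (u, v)` is the constant gate `0` (value `true`) or `1` (value
`false`) according to `h (u, v)` if `u, v < t`, and the input `(u, v)` itself otherwise: it points
into the first `2` gates, reads off `[true, false]` the overwritten input, and intertwines the
diagonal action of every permutation fixing all indices `< t`. -/
theorem exists_headerWire (m t : ℕ) (h : Fin m × Fin m → Bool) :
    ∃ φ : Fin m × Fin m → (Fin m × Fin m) ⊕ ℕ,
      WiresOK 2 φ ∧
      (∀ (x : Fin m × Fin m → Bool) (q : Fin m × Fin m),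
        wireOf x [true, false] (φ q) = if (q.1 : ℕ) < t ∧ (q.2 : ℕ) < t then h q else x q) ∧
      ∀ ρ : Equiv.Perm (Fin m), (∀ i : Fin m, (i : ℕ) < t → ρ i = i) → ∀ q : Fin m × Fin m,
        φ (ρ q.1, ρ q.2) = Sum.map (fun q : Fin m × Fin m => (ρ q.1, ρ q.2)) id (φ q) := by
  refine ⟨fun q => if (q.1 : ℕ) < t ∧ (q.2 : ℕ) < t then (if h q = true then Sum.inr 0
    else Sum.inr 1) else Sum.inl q, ?_, ?_, ?_⟩
  · intro q k hk
    dsimp only at hk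
    by_cases hq : (q.1 : ℕ) < t ∧ (q.2 : ℕ) < t
    · rw [if_pos hq] at hk
      split_ifs at hk <;> (simp only [Sum.inr.injEq] at hk; omega)
    · rw [if_neg hq] at hk
      cases hk
  · intro x q
    dsimp only
    by_cases hq : (q.1 : ℕ) < t ∧ (q.2 : ℕ) < t
    · rw [if_pos hq, if_pos hq]
      cases hh : h q <;> rfl
    · rw [if_neg hq, if_neg hq]
      rfl
  · intro ρ hρ q
    by_cases hq : (q.1 : ℕ) < t ∧ (q.2 : ℕ) < t
    · have hπq : (ρ q.1, ρ q.2) = q := Prod.ext (hρ q.1 hq.1) (hρ q.2 hq.2)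
      rw [hπq]
      dsimp only
      rw [if_pos hq]
      cases h q <;> rfl
    · dsimp only
      have hq' : ¬ (((ρ q.1 : Fin m) : ℕ) < t ∧ ((ρ q.2 : Fin m) : ℕ) < t) := fun hh =>
        hq ⟨lt_of_apply_lt hρ hh.1, lt_of_apply_lt hρ hh.2⟩
      rw [if_neg hq', if_neg hq]
      rfl

/-- **The constant prefix** `[∧₀, ∨₀]` (as the wireless gates `GateList.constGate true/false`,
whose gate functions `GateFn.const b` are `∧₀`, `∨₀ ∈ acBasis ⊆ tcBasis` by extensionality):
two arity-`0` gates over `tcBasis`, well formed, with values `[true, false]`. -/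
theorem exists_constPre (ι : Type*) :
    ∃ pre : List (Gate ι), pre.length = 2 ∧ (∀ g ∈ pre, g.arity = 0) ∧
      (∀ g ∈ pre, g.fn ∈ tcBasis) ∧ (∀ x : ι → Bool, vals pre x = [true, false]) ∧ WF pre := by
  refine ⟨[constGate ι true, constGate ι false], rfl, ?_, ?_, fun _ => rfl, ?_⟩
  · intro g hg
    simp only [List.mem_cons, List.not_mem_nil, or_false] at hg
    rcases hg with rfl | rfl <;> rfl
  · intro g hg
    simp only [List.mem_cons, List.not_mem_nil, or_false] at hg
    rcases hg with rfl | rfl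
    · exact acBasis_subset_tcBasis (const_mem_acBasis true)
    · exact acBasis_subset_tcBasis (const_mem_acBasis false)
  · exact (WF.singleton (gateOK_constGate 0 true)).append_singleton (gateOK_constGate 1 false)

end HeaderHardwiring

open HeaderHardwiring in
/-- **S3 — symmetric circuits are closed under hard-wiring constants into `Γ`-fixed inputs.**
If some `Γ`-symmetric `tcBasis`-circuit of size `≤ s` computes `f`, and every `ρ ∈ Γ` fixes the
header coordinates `< t` pointwise, then for every constant header block `h` some `Γ`-symmetric
`tcBasis`-circuit of size `≤ s + 2` computes `x ↦ f (x with its header block overwritten by h)`.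
Construction: prepend the two constant gates `∧₀ = 1`, `∨₀ = 0` (both in `acBasis ⊆ tcBasis`),
shift every back-reference by `2`, and rewire each header input wire `(u, v)` (`u, v < t`) to the
constant `h (u, v)`; the automorphism extending `ρ` is `id ⊕ σ`. Folklore (Anderson–Dawar 2017,
§2, restrictions of symmetric circuits). -/
theorem stub_headerHardwiring :
    ∀ (m t s : ℕ) (Γ : Set (Equiv.Perm (Fin m))),
      (∀ ρ ∈ Γ, ∀ i : Fin m, (i : ℕ) < t → ρ i = i) →
      ∀ (f : (Fin m × Fin m → Bool) → Bool) (h : Fin m × Fin m → Bool),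
        HasSymCircuit tcBasis Γ s f →
        HasSymCircuit tcBasis Γ (s + 2)
          (fun x => f (fun q => if (q.1 : ℕ) < t ∧ (q.2 : ℕ) < t then h q else x q)) := by
  intro m t s Γ hΓ f h hf
  obtain ⟨C, hB, hs, hsym, hcomp⟩ := hf
  obtain ⟨φ, hφ2, hφv, hφΓ⟩ := exists_headerWire m t h
  obtain ⟨pre, hpreL, hpre0, hpreB, hpreV, hpreWF⟩ := exists_constPre (Fin m × Fin m)
  have hφ : WiresOK pre.length φ := by
    rw [hpreL]
    exact hφ2
  obtain ⟨D, hDg, hDo⟩ := exists_hardwire pre hpreWF C φ hφ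
  refine ⟨D, isOver_hardwire pre hpreB C D hB φ pre.length hDg, ?_, ?_, ?_⟩
  · have h1 := size_hardwire pre C D φ pre.length hDg
    have h2 : C.size ≤ s := hs
    omega
  · exact isSymmetricUnder_hardwire Γ pre hpre0 C D φ hφ hDg hDo
      (fun ρ hρ q => hφΓ ρ (hΓ ρ hρ) q) hsym
  · intro x
    rw [eval_hardwire pre C D φ hφ hDg hDo x, hcomp, hpreV x]
    exact congrArg f (funext fun q => hφv x q)

end Summit.PneNP.PneNP.Theorems
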